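import Summits.Ventures.PercRepro.C017K5

/-!
# `C017UpTo 5`: C-017 on every multigraph with at most five vertices, kernel-checked end to end

C-017 (mine-3's Q1): `P(a~b)·P(a≁b) ≤ P(exactly one of the pairs ab, ac, bc is connected)` for every
marked multigraph, every `p ∈ [0,1]^E`, every three marks.  typer-2's `C017UpTo_of_simpleInj`
(Injective.lean, on `ClassPositive.lean`) reduces it on `≤ N` vertices to the class census over the
SIMPLE graphs with `≤ N` vertices and INJECTIVE 3-markings.  Every simple graph on five vertices is a
spanning subgraph of `K₅`, every injective 3-marking is `0, 1, 2` after a permutation of the vertices,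
and `check17_k5` (C017K5.lean) decides the census on the faces `[⊥, u]` of `K₅` with marks `0, 1, 2`:

* `pairIdx5` / `ιOf` / `subOf_graphOf` — the edges of `graphOf B` inside `K₅`; `m₀` / `exists_perm_of_injective`
  — the relabelling (`Equiv.extendSubtype`); `cubeSumQuad_eq_graphOf_adjOf` — a simple graph on `Fin n` has
  the class sums of the graph of its adjacency matrix (any kernel; typer-2's `edgeEquiv`, `SameEnds`);
* **`census17`** — `0 ≤ CS₁₇(graphOf B, m)` for every adjacency matrix `B` on five vertices and every injective
  `m`; **`ClassPositiveSimpleInjUpTo_of_graphOf`** — the generic transfer of such a census to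
  `ClassPositiveSimpleInjUpTo k n A`;
* **`classPositive17_5 : ClassPositiveSimpleInjUpTo 3 5 kernel17`** and **`c017UpTo5 : C017UpTo 5`**: C-017 on
  EVERY multigraph with at most five vertices, for every `p` and every marking (injective or not) — the
  three kernel slices of `C017K5.lean` plus the reduction chain, no computation outside the Lean kernel.
-/

namespace PercRepro

namespace C017

open MultiGraph

/-- The index of the pair `(i, j)`, `i < j`, in the edge order of `k5` (`01, 02, 03, 04, 12, 13, 14, 23,
24, 34`); `0` elsewhere. -/
def pairIdx5 : Fin 5 → Fin 5 → Fin 10 :=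
  ![![0, 0, 1, 2, 3], ![0, 0, 4, 5, 6], ![0, 0, 0, 7, 8], ![0, 0, 0, 0, 9], ![0, 0, 0, 0, 0]]

/-- The endpoints of `pairIdx5 i j` in `k5` are `i`, `j` (for `i < j`). -/
theorem k5_pairIdx5 : ∀ i j : Fin 5, i < j →
    Examples.k5.fst (pairIdx5 i j) = i ∧ Examples.k5.snd (pairIdx5 i j) = j := by
  decide

/-- `pairIdx5` is injective on increasing pairs. -/
theorem pairIdx5_injective : ∀ i j i' j' : Fin 5, i < j → i' < j' →
    pairIdx5 i j = pairIdx5 i' j' → i = i' ∧ j = j' := by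
  decide

/-- The edges of `graphOf B` as edges of `K₅`. -/
def ιOf (B : Fin 5 → Fin 5 → Bool) : EdgesOf B → Fin 10 := fun e => pairIdx5 e.1.1 e.1.2

/-- `graphOf B` sits inside `K₅` along `ιOf B`. -/
theorem subOf_graphOf (B : Fin 5 → Fin 5 → Bool) : (graphOf B).SubOf Examples.k5 (ιOf B) := by
  refine ⟨?_, fun e => Or.inl (k5_pairIdx5 e.1.1 e.1.2 e.2.1)⟩
  intro e e' h
  obtain ⟨h1, h2⟩ := pairIdx5_injective e.1.1 e.1.2 e'.1.1 e'.1.2 e.2.1 e'.2.1 h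
  exact Subtype.ext (Prod.ext h1 h2)

/-- The marking `0, 1, 2` of `Fin 5`. -/
def m₀ : Fin 3 → Fin 5 := ![0, 1, 2]

/-- `m₀` is injective. -/
theorem m₀_injective : Function.Injective m₀ := by
  intro i j h
  revert i j
  decide

open Classical in
/-- **Relabelling**: an injective 3-marking of `Fin 5` is `m₀` after a permutation of the vertices. -/
theorem exists_perm_of_injective (m : Fin 3 → Fin 5) (hm : Function.Injective m) :
    ∃ π : Equiv.Perm (Fin 5), ∀ i, π (m i) = m₀ i := by
  let e : {x : Fin 5 // x ∈ Set.range m} ≃ {x : Fin 5 // x ∈ Set.range m₀} :=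
    (Equiv.ofInjective m hm).symm.trans (Equiv.ofInjective m₀ m₀_injective)
  refine ⟨e.extendSubtype, fun i => ?_⟩
  rw [e.extendSubtype_apply_of_mem (m i) ⟨i, rfl⟩]
  show ((Equiv.ofInjective m₀ m₀_injective) ((Equiv.ofInjective m hm).symm ⟨m i, ⟨i, rfl⟩⟩) : Fin 5) = m₀ i
  rw [Equiv.ofInjective_symm_apply hm i]
  rfl

/-- `graphOf A` is a simple graph (pairs `i < j`, each at most once). -/
theorem isSimple_graphOf (n : ℕ) (A : Fin n → Fin n → Bool) : (graphOf A).IsSimple := by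
  constructor
  · intro e h
    exact absurd h (ne_of_lt e.2.1)
  · intro e e' h
    rcases h with ⟨h1, h2⟩ | ⟨h1, h2⟩
    · exact Subtype.ext (Prod.ext h1 h2)
    · exfalso
      have := e.2.1
      have := e'.2.1
      simp only [graphOf] at h1 h2
      omega

/-- **A simple graph on `Fin n` has the class sums of the graph of its adjacency matrix** (any kernel). -/
theorem cubeSumQuad_eq_graphOf_adjOf {n : ℕ} {E : Type*} [Fintype E] [DecidableEq E]
    (G : MultiGraph (Fin n) E) (hs : G.IsSimple) {k : ℕ} (m : Fin k → Fin n)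
    (A : Setoid (Fin k) → Setoid (Fin k) → ℝ) :
    G.cubeSumQuad m A = (graphOf (adjOf G)).cubeSumQuad m A := by
  rw [← G.cubeSumQuad_mapEdges (G.edgeEquiv hs) m A]
  exact (cubeSumQuad_eq_of_sameEnds (G.sameEnds_graphOf_adjOf hs) m A).symm

/-- **The adjacency-matrix census on five vertices for `kernel17`**: `0 ≤ CS₁₇(graphOf B, m)` for every
matrix `B` and every injective 3-marking `m` — from the faces `[⊥, u]` of `K₅`. -/
theorem census17 (B : Fin 5 → Fin 5 → Bool) (m : Fin 3 → Fin 5) (hm : Function.Injective m) :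
    0 ≤ (graphOf B).cubeSumQuad m kernel17 := by
  obtain ⟨π, hπ⟩ := exists_perm_of_injective m hm
  rw [← (graphOf B).cubeSumQuad_mapVertices π.injective m kernel17]
  have hcomp : (⇑π ∘ m) = m₀ := funext hπ
  rw [hcomp, cubeSumQuad_eq_graphOf_adjOf _
    ((graphOf B).isSimple_mapVertices π.injective (isSimple_graphOf 5 B))]
  rw [show m₀ = ![0, 1, 2] from rfl, cubeSumQuad_kernel17_eq,
    (graphOf _).cubeSum17Z_eq_faceSlack17Z_sub Examples.k5 (subOf_graphOf _) 0 1 2]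
  exact_mod_cast Examples.k5.faceSlack17Z_nonneg_of_check 0 1 2 Examples.check17_k5 _

/-- **The adjacency-matrix census gives the injective simple census on `≤ n` vertices** (any kernel):
if `0 ≤ CS_A(graphOf B, m)` for every matrix `B : Fin n → Fin n → Bool` and every injective marking
`m : Fin k → Fin n`, then `ClassPositiveSimpleInjUpTo k n A`. -/
theorem ClassPositiveSimpleInjUpTo_of_graphOf (k n : ℕ) (A : Setoid (Fin k) → Setoid (Fin k) → ℝ)
    (h : ∀ (B : Fin n → Fin n → Bool) (m : Fin k → Fin n), Function.Injective m →
      0 ≤ (graphOf B).cubeSumQuad m A) : ClassPositiveSimpleInjUpTo k n A := by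
  intro V E _ _ _ hV G hs m hm
  obtain ⟨ι⟩ : Nonempty (V ↪ Fin n) :=
    Function.Embedding.nonempty_of_card_le (by simpa using hV)
  rw [← G.cubeSumQuad_mapVertices ι.injective m A,
    cubeSumQuad_eq_graphOf_adjOf _ (G.isSimple_mapVertices ι.injective hs)]
  exact h _ _ (ι.injective.comp hm)

end C017

/-- **`kernel17` is class-positive on every simple graph with ≤ 5 vertices and every injective
3-marking** — kernel-checked (the three slices of `C017K5.lean`). -/
theorem classPositive17_5 : ClassPositiveSimpleInjUpTo 3 5 kernel17 :=
  C017.ClassPositiveSimpleInjUpTo_of_graphOf 3 5 kernel17 C017.census17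

/-- **C-017 on every multigraph with at most five vertices, every `p`, every marking** — kernel-checked
end to end: `P(a~b)·P(a≁b) ≤ P(ab|c) + P(ac|b) + P(bc|a)`. -/
theorem c017UpTo5 : C017UpTo 5 := C017UpTo_of_simpleInj classPositive17_5

end PercRepro
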